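import Literature.NumberTheory.EllipticCurves.Kato2004.LocalIwasawaCohomologyMap
import Literature.NumberTheory.EllipticCurves.GreenbergSelmer
import HarnessLib

/-!
# Tate local duality along the cyclotomic `ℤ_p`-tower, READ on Kato's pinned carriers `𝐇¹_{loc,Γ}(T_pW)`
# (`LocalIwasawaH1Data`), `𝐇¹_{loc,Γ}(F⁺T_pW)` (`ordinaryInclusion`) and `𝐇¹_Γ(T_pW)` (`IwasawaH1Data.loc`):
# the `Λ`-adic local Tate pairing against `H¹(ℚ_∞, E[p^∞])` through `loc_v`, its orthogonality to the ordinary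
# part and to the global Iwasawa classes on the Selmer group — ONE existence statement (named fact), nothing else

Topic `NumberTheory/EllipticCurves/Kato2004` (namespace = path; the carriers live here).  Width seat
`cruxlead-stmt-BirchSwinnertonDyer-19573-w3` g4 (cell `pub/bsd-2adic`; crux `OrdKatoHalfAtTwoIso` = item 19573 of
`Summits/BirchSwinnertonDyer`, K4 child 24097, line `steinberg-fibre-at-two`): the width seat g3 reduced the `Δ < 0` conjunct of
the child to exactly TWO typed inputs on Kato's carriers (`Summits/…/Theorems/…ZetaColemanMuIotaKatoCarriers.lean`, hypotheses
`hpairPT` and `hcolERL`); `hpairPT` is CLASSICAL at every prime `p` (Tate local duality at the layers, the Kummer condition at an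
ordinary prime, Poitou–Tate), and this file states it ONCE, for every `p`, as a named fact on the tree's carriers — VERBATIM the
hypothesis `hpairPT` with `2 ↦ p` — so that the Summits side consumes it BY NAME and the memo-grade content of that conjunct is the
second input alone.

HONEST FRAMING: ONE named fact (`def … : Prop`, +1 declared debt), a PRINT-COMPOSITE READING — each clause below is a printed
theorem valid at every prime `p` (including `p = 2`), read on the tree's pinned carriers; the composite `∃` is not a sentence of
any single source.  Nothing is asserted; no `_holds`; no instance, no notation, no `sorry`; nothing here is specific to any
summit; BSD is not proved by any of this.
-- TODO(general form): THE pairing as a DEFINITION (cup product on `H¹(U_n, T/p^k) × H¹(U_n, E[p^k])`, `inv` of `ℚ_{n,v}`,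
-- `ℤ_p`-adic and `Λ`-adic limits — the tree has the finite-coefficient layer pairings `CyclotomicLayer.layerPairingPk` and the
-- gluing lemmas of `Literature/Algebra/InverseSystem/`) with (K)–(R) as THEOREMS; perfectness (injectivity on `J.H`) is printed
-- too but not consumed, hence not stated; number fields other than `ℚ`; general `p`-adic representations `T` with `T^∨(1)`.

## The printed statements

* **Tate local duality** (J. Tate 1962; [MilneADT2006, Ch. I Cor. 2.3 (p. 28) and Thm. 2.14]; [SerreGaloisCohomology1997, II §5.2
  Thm. 2]; used verbatim at every `p`, archimedean places included, in [GreenbergLNM1716, §4 (8) (p. 121)] «the perfect pairing (from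
  Tate's local duality theorems) `H¹(F_v, M) × H¹(F_v, T*) → ℚ_p/ℤ_p`»; Kato states the `𝐇²_loc` case in §12.2 (p. 220) «By local Tate
  duality [Se1, Chap. II §5.2]» and (14.9) (p. 239) «We have the local Tate duality `{H^q(K ⊗ ℚ_p, T*(1) ⊗ ℚ/ℤ)}^∨ ≅ H^{2−q}(K ⊗ ℚ_p, T)`»
  with no parity proviso): for a finite extension `L/ℚ_v` and a finite `Gal(L̄/L)`-module `M` the cup product and the invariant map
  give a PERFECT pairing `H¹(L, M) × H¹(L, M^∨(1)) → ℚ/ℤ`; it is natural (restriction is adjoint to corestriction,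
  [NeukirchSchmidtWingberg2008, (1.5.3)(iv) and Cor. 7.1.4]) and invariant under `Gal(L̄/ℚ_v)`-conjugation.  For `T = T_pE`,
  `M = T/p^k = E[p^k]` and `M^∨(1) = E[p^k]` by the Weil pairing ([SilvermanAEC2009, III.8.1]); passing to `lim←_k` and then to
  `lim←_n` along the corestrictions of the tower `ℚ_{n,v}` (the tree's `LocalIwasawaH1Data`: `𝐇¹_{loc,Γ}(T) = lim←_n H¹(U_n, T)`,
  `U_n = Gal(ℚ̄_v/ℚ_{n,v})`) on one side and to `lim→` along the restrictions on the other
  (`H¹(U_∞, E[p^∞]) = lim→_n H¹(U_n, E[p^∞])`, [SerreGaloisCohomology1997, I §2.2 Prop. 8]) gives the `Λ`-adic pairing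
  `𝐇¹_{loc,Γ}(T_pE) × H¹(ℚ_{∞,v}, E[p^∞]) → ℚ_p/ℤ_p`, `(u, t) ↦ lim_n inv_v(u_n ∪ t_n)`, `ℤ_p`-bilinear, with `⟨(σ − 1)u, t⟩ =
  ⟨u, (σ⁻¹ − 1)t⟩` for `σ ∈ Gal(ℚ̄_v/ℚ_v)`, identifying `𝐇¹_{loc,Γ}(T_pE)` with the FULL Pontryagin dual `Hom(H¹(ℚ_{∞,v}, E[p^∞]), ℚ_p/ℤ_p)`
  (the `Λ`-adic form is the standard one of [PerrinRiou1994Invent, §3.6.1] — stated there for odd `p`; the limit argument is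
  parity-free).
* **The Kummer condition at a good ORDINARY prime** [GreenbergLNM1716, §2 Prop. 2.2 and its proof, part (i) (p. 73)]: for `v ∣ p`
  good ordinary, `C_v = ker(E[p^∞] → Ẽ[p^∞]) = 𝓕(𝔪̄)[p^∞]` (the formal group), and for every finite extension `M_η/F_v`
  «`Im(κ_η) ⊆ Im(λ_η)`», `λ_η : H¹(M_η, C_v) → H¹(M_η, E[p^∞])` — no parity proviso (the cofinitely many layers `ℚ_{n,v}` and their
  union).  With `F⁺T = T_p(E₁(ℚ̄_v))` (the tree's `tateModuleFilAt`, `C_v = F⁺T ⊗ ℚ_p/ℤ_p`) of `ℤ_p`-rank one at an ordinary prime,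
  the Weil pairing vanishes on `F⁺T × C_v` (`E₁[p^m] = 𝓕[p^m]` is cyclic and `e_{p^m}` is alternating, [SilvermanAEC2009, III.8.1,
  IV.3.2, VII.2]), so the local Tate pairing kills `im H¹(·, F⁺T) × im H¹(·, C_v)`, in particular `im 𝐇¹_{loc,Γ}(F⁺T) × loc_v(Sel)`.
* **Poitou–Tate / the reciprocity law of the Brauer group** ([MilneADT2006, Ch. I Thm. 4.10]; [GreenbergLNM1716, §4 (p. 122)] «The
  duality theorems of Poitou and Tate imply that `G` and `G*` are also orthogonal complements» — the images of the GLOBAL classes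
  in `∏_{v ∈ Σ} H¹(F_v, ·)`, `Σ ∋ p, ∞`, at every `p`; [Kato2004Asterisque, (14.9.1)–(14.9.2) (p. 239)]): for global classes
  `a ∈ H¹(ℚ_n, T/p^k)`, `b ∈ H¹(ℚ_n, E[p^k])` one has `Σ_w inv_w(a_w ∪ b_w) = 0` over all places `w` of `ℚ_n` (finitely many non-zero
  terms; exact at `p = 2` since the real places are included).  For `b` a SELMER class the terms at `w ∤ p` vanish: `Im κ_w = 0` for
  `w ∤ p`, finite or archimedean ([GreenbergLNM1716, §2 Prop. 2.1 (p. 72)] «If `η ∤ p`, then `Im(κ_η) = 0`», proved there for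
  `l = ∞` as well: `E(M_η) ⊗ ℚ_p/ℤ_p = 0`; and §4 (p. 106) «We know that `Im(κ_{v_n}) = 0` for `v_n ∣ v`», `v` archimedean — at
  `p = 2` the group `H¹(ℝ, E[2^∞])` may be non-zero but the Selmer classes are trivial there), and `p` has exactly ONE place
  above it in every layer `ℚ_n` of the cyclotomic `ℤ_p`-extension (totally ramified); `Sel_{p^∞}(E/ℚ_∞) = lim→ Sel_{p^∞}(E/ℚ_n)`
  ([GreenbergLNM1716, §1]; [Mazur1972, §6]).  Hence
  `⟨loc_v 𝐠, s⟩ = 0` for every norm-compatible global family `𝐠 ∈ 𝐇¹_Γ(T_pE)` and every `s ∈ Sel_{p^∞}(E/ℚ_∞)`.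

## READING (what the `def` says, clause by clause; `Λ = ℤ_p⟦X⟧`, `κ` the cyclotomic `ℤ_p`-extension of `ℚ`, `γ ∈ Γ_ℚ` and
## `γᵥ ∈ Γ_{ℚ_v}` normalised topological generators (`κ γ = κ(res γᵥ) = 1`), `v` the place above `p`, `W` good ordinary at `p`)

For the pinned carriers `I = 𝐇¹_Γ(T_pW)`, `J = 𝐇¹_{loc,Γ}(T_pW|_{Γ_{ℚ_v}})`, `J' = 𝐇¹_{loc,Γ}(F⁺T_pW)` there is
`toDualP : J.H → Hom(H¹(ker κ, E[p^∞]), ℚ/ℤ)` — the `Λ`-adic Tate pairing composed with the restriction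
`res : H¹(ker κ, ·) → H¹(ker κ ⊓ D_v, ·) = H¹(ℚ_{∞,v}, ·)` (`D_v = decomp v`, the decomposition group of the chosen embedding, through
which `J` is pinned; `Γ_{ℚ_v} ≅ D_v`) — such that
* (K) `toDualP x s` depends only on `res s` (by construction);
* (T) `toDualP (X•x) s = toDualP x (conj_{γ⁻¹} s) − toDualP x s`: `X` acts on `J.H` as `conj_{γᵥ} − 1` (`proj_T_smul`), the pairing is
  conjugation-invariant, and `conj_γ = conj_{res γᵥ}` on `H¹(ker κ, ·)` because `γ⁻¹·res γᵥ ∈ ker κ` acts trivially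
  ([SerreGaloisCohomology1997, I §2.2]; [NeukirchSchmidtWingberg2008, (1.6.3)]);
* (C) `ℤ_p`-bilinearity read on `p^k`-torsion values: `toDualP (C c•x) s = (c mod p^k)·toDualP x s` whenever `p^k·toDualP x s = 0`;
* (S) every character of `H¹(ker κ, E[p^∞])` vanishing on `ker res` is a `toDualP x`: characters of `im res` extend to
  `H¹(ℚ_{∞,v}, E[p^∞])` (`ℚ/ℤ` is injective) and `J.H` is its full Pontryagin dual;
* (I) `toDualP (ordinaryInclusion y) s = 0` for `y ∈ 𝐇¹_{loc,Γ}(F⁺T)`, `s ∈ Sel_{p^∞}(E/ℚ_∞)` (Greenberg 2.2 (i) + isotropy of `F⁺`);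
* (R) `toDualP (loc 𝐠) s = 0` for `𝐠 ∈ 𝐇¹_Γ(T_pW)`, `s ∈ Sel_{p^∞}(E/ℚ_∞)` (Poitou–Tate at the layers, as above).
The binders `κ.IsCyclotomic`, `hsurj`, `hγ`, `hγᵥ` are those under which the tree DEFINES `IwasawaH1Data.loc`; the three instance
binders on `W.tateModule p` are structure facts (dischargeable, `TateModule.continuousSMul_padicInt` etc.), as in
`EulerSystemValues.tateRep`.

## Why it might be wrong (for the auditor)
Only through a mismatch between the tree's objects and the printed ones: (i) the tree's `H1`/`subgroupH1` are Mathlib's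
CONTINUOUS cohomology (`continuousCohomology 1`) of the profinite groups with `p`-adic resp. discrete coefficients — the printed
setting; (ii) `localLayerCores`/`layerCores` are the tree's corestrictions `coresLe` (NSW I §5) and `localLayerConj`/`conjH1` the
standard left conjugation action — the printed transition/Galois maps; (iii) the tree's `selmerGroupOver` imposes the Kummer
condition at EVERY place through every conjugate embedding (archimedean ones included: it is STRICT at `∞`, the reading used in
(R) at `p = 2`); (iv) `decomp v` is the range of `absGaloisRestrict ℚ ℚ_v`, the same map as `resGalOfEmb (closureEmb ℚ_v)` pinning `J`
(both are restriction along the tree's chosen embedding `closureEmb`).  No clause loses a factor `2` at `p = 2`: (K)(T)(C)(S)(I) are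
local at `v ∣ p`, and (R) uses the reciprocity law with the real places included.  Consumer:
`Summits/BirchSwinnertonDyer/BirchSwinnertonDyer/Theorems/ByReductionTypeAtTwoOrdKatoHalfAtTwoIsoZetaColemanMuIotaTateDualityFact.lean`
(the fact at `p = 2` is `hpairPT` of `…ZetaColemanMuIotaKatoCarriers.lean` by `fun h => h 2`).

## References
* [MilneADT2006] J. S. Milne, *Arithmetic Duality Theorems*, 2nd ed. (2006), Ch. I Cor. 2.3 (p. 28), Thm. 2.14, Thm. 4.10.
* [SerreGaloisCohomology1997] J.-P. Serre, *Galois Cohomology* (1997), I §2.2 Prop. 8, II §5.2 Thm. 2.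
* [GreenbergLNM1716] R. Greenberg, *Iwasawa theory for elliptic curves*, LNM 1716 (1999): §1, §2 Prop. 2.1 (p. 72) and Prop. 2.2 (p. 73), §4 (8)
  (p. 121), p. 122, p. 106 — read 2026-08-29 from the store text `book:coates1999-arithmetic-theory-elliptic-curves` pp. 70–74, 106, 121–122.
* [Kato2004Asterisque] K. Kato, Astérisque 295 (2004): §12.2 (p. 220), §14.9 (14.9.1)–(14.9.2) (p. 239), §17.13 (17.13.1) (p. 279) —
  store `paper:doi-10-24033-ast-639` pp. 105, 124.
* [PerrinRiou1994Invent] B. Perrin-Riou, Invent. Math. 115 (1994), §3.6.1 (the `Λ`-adic pairing; `p` odd there).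
* [NeukirchSchmidtWingberg2008] I §5 (1.5.3)(iv), (1.6.3), VII Cor. 7.1.4; [SilvermanAEC2009] III.8.1, IV.3.2, VII.2; [Mazur1972] §6.
* Tree: `Kato2004/LocalIwasawaCohomology.lean` (`LocalIwasawaH1Data`, `IwasawaH1Data.loc`), `Kato2004/LocalIwasawaCohomologyMap.lean`
  (`tateLocalOrdinaryRep`, `ordinaryInclusion`), `IwasawaSelmer.lean` (`selmerInfty`), `SubgroupSelmer.lean` (`subgroupH1`, `resOfLe`,
  `conjH1`), `GreenbergSelmer.lean` (`decomp`), `CyclotomicLayerTatePairing.lean` (the finite-coefficient layer pairings, for the TODO).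
-/

open scoped NumberField
open Field IsDedekindDomain WeierstrassCurve
open Literature.NumberTheory.GaloisRepresentations
open Literature.NumberTheory.EllipticCurves Literature.NumberTheory.EllipticCurves.GreenbergSelmer
open Literature.NumberTheory.EllipticCurves.Kato2004 Literature.NumberTheory.EllipticCurves.Kato2004.EulerSystemValues

namespace Literature.NumberTheory.EllipticCurves.Kato2004

/-- **Tate local duality along the cyclotomic `ℤ_p`-tower on Kato's pinned carriers, with its orthogonality to the ordinary
part and to the global Iwasawa classes on the Selmer group** (Tate 1962 / Milne ADT I Cor. 2.3; Greenberg LNM 1716 Prop. 2.2 (i),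
§4 (8) and p. 122 (Poitou–Tate), p. 106; READ on the tree's carriers as in the module docstring, clauses (K)(T)(C)(S)(I)(R)).
For `W/ℚ` globally minimal and good ORDINARY at `p`, the cyclotomic `ℤ_p`-extension `κ` with a normalised topological generator
`γ`, the place `v ∋ p`, a normalised local generator `γᵥ`, and ALL pinned carriers `I = 𝐇¹_Γ(T_pW)`, `J = 𝐇¹_{loc,Γ}(T_pW|_{Γ_{ℚ_v}})`,
`J' = 𝐇¹_{loc,Γ}(F⁺T_pW)`: there is `toDualP : J.H →+ Hom(H¹(ker κ, E[p^∞]), ℚ/ℤ)` (print: `u ↦ (s ↦ lim_n inv_v(u_n ∪ res_v s))`)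
which (K) factors through the restriction to `ker κ ⊓ D_v`, (T) is adjoint for `γ ↔ γ⁻¹` (`X` acts on `J.H` as `conj_{γᵥ} − 1`),
(C) is `ℤ_p`-bilinear on `p^k`-torsion values, (S) reaches every character vanishing on the kernel of that restriction, (I) kills
`range(𝐇¹_{loc,Γ}(F⁺T) → 𝐇¹_{loc,Γ}(T)) × Sel_{p^∞}(E/ℚ_∞)`, and (R) kills `loc_v(𝐇¹_Γ(T_pW)) × Sel_{p^∞}(E/ℚ_∞)`.  PRINT-COMPOSITE
reading at every prime `p` (no parity proviso in any clause); nothing asserted.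
-- TODO(general form): the pairing as a definition with (K)–(R) and perfectness as theorems; number fields; general `T`.
[cite: MilneADT2006, Ch. I Cor. 2.3 (p. 28) and Thm. 4.10] [cite: GreenbergLNM1716, §2 Prop. 2.1 (p. 72), Prop. 2.2 (p. 73), §4 (8) (p. 121), p. 122, p. 106]
[cite: Kato2004Asterisque, §12.2 (p. 220) and (14.9.1)–(14.9.2) (p. 239)] [cite: SerreGaloisCohomology1997, I §2.2 Prop. 8 and II §5.2 Thm. 2]
[cite: PerrinRiou1994Invent, §3.6.1 (shape of the Λ-adic pairing)] -/
def exists_lambdaAdicLocalTatePairing_selmer_orthogonal : Prop :=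
  ∀ (p : ℕ) [Fact p.Prime] (W : WeierstrassCurve ℚ) [W.IsElliptic] [W.IsGloballyMinimal]
    [ContinuousSMul ℤ_[p] (W.tateModule p)] [Module.Free ℤ_[p] (W.tateModule p)] [Module.Finite ℤ_[p] (W.tateModule p)]
    (κ : ZpExtension ℚ p) (γ : absoluteGaloisGroup ℚ) (_hκ : κ.IsCyclotomic) (hγ : κ.IsTopGenerator γ),
    IsOrdinaryAt W p →
    ∀ (v : HeightOneSpectrum (𝓞 ℚ)) (_ : ((p : ℕ) : 𝓞 ℚ) ∈ v.asIdeal)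
      (γᵥ : absoluteGaloisGroup (v.adicCompletion ℚ))
      (hsurj : Function.Surjective
        (κ.toContinuousMonoidHom.comp (resGalOfEmb (closureEmb (K := ℚ) (v.adicCompletion ℚ)))))
      (hγᵥ : κ.IsTopGenerator (resGalOfEmb (closureEmb (K := ℚ) (v.adicCompletion ℚ)) γᵥ))
      (I : IwasawaH1Data W p κ γ) (J : LocalIwasawaH1Data κ v ((tateRep W p).toLocal v) γᵥ)
      (J' : LocalIwasawaH1Data κ v (tateLocalOrdinaryRep W p v) γᵥ),
    ∃ toDualP : J.H →+ (W.subgroupH1 p κ.kerSubgroup →+ AddCircle (1 : ℚ)),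
      (∀ (x : J.H) (s : W.subgroupH1 p κ.kerSubgroup),
        W.resOfLe p (inf_le_left : κ.kerSubgroup ⊓ decomp v ≤ κ.kerSubgroup) s = 0 → toDualP x s = 0) ∧
      (∀ (x : J.H) (s : W.subgroupH1 p κ.kerSubgroup),
        toDualP ((PowerSeries.X : IwasawaAlgebra p) • x) s =
          toDualP x (W.conjH1 p κ.kerSubgroup γ⁻¹ s) - toDualP x s) ∧
      (∀ (c : ℤ_[p]) (x : J.H) (s : W.subgroupH1 p κ.kerSubgroup) (k : ℕ), p ^ k • toDualP x s = 0 →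
        toDualP (PowerSeries.C c • x) s = (PadicInt.toZModPow k c).val • toDualP x s) ∧
      (∀ χ : W.subgroupH1 p κ.kerSubgroup →+ AddCircle (1 : ℚ),
        (∀ s, W.resOfLe p (inf_le_left : κ.kerSubgroup ⊓ decomp v ≤ κ.kerSubgroup) s = 0 → χ s = 0) →
          ∃ x : J.H, toDualP x = χ) ∧
      (∀ (y : J'.H) (s : W.selmerInfty κ), toDualP (J'.ordinaryInclusion J y) s = 0) ∧
      (∀ (g : I.H) (s : W.selmerInfty κ), toDualP (I.loc J hsurj hγ hγᵥ g) s = 0)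

end Literature.NumberTheory.EllipticCurves.Kato2004
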